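import Literature.AlgebraicGeometry.HodgeTheory.CartierDivisorChernClass
import Literature.Geometry.Kaehler.HolomorphicLineBundleCechTwist
import Literature.Geometry.Kaehler.HolomorphicLineBundleSections
import HarnessLib

/-!
# The tower `L ⊗ 𝒪_X(mH)^an` of a line cocycle twisted by multiples of a Cartier divisor

Layer `Literature/AlgebraicGeometry/HodgeTheory`. For a Cartier divisor `H` on an integral scheme
`X` over `ℂ` with analytification `φ : M → X(ℂ)`, and a cocycle line bundle `L` on `M`
(`Literature.Geometry.Kaehler.HolomorphicLineBundle`), the bundles

  `L_m = L ⊗ 𝒪_X(m • H)^an`   (`twistBundle`, index type `ι × H.ι`)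

all live on the SAME trivialising cover `U_i ∩ φ⁻¹(U_a(ℂ))` (`m • H` is presented on the cover of
`H` with local equations `f_a ^ m`, `CartierDivisor.nsmul`), with transition functions
`g_ij · ((f_b/f_a) ∘ φ)^m` (`cartierDivisorLineBundle_nsmul_coordChange`, through the germs). An algebraic section
`s ∈ Γ(X, 𝒪_X(H)) ⊆ K(X)` (`H.IsSection s`, coordinates `s_a = (f_a s) ∘ φ`,
`CartierDivisor.sectionCoord`) then defines, for every `m`, a section of
`Hom(L_m, L_{m+1}) = 𝒪_X(H)^an` (`homSectionOfIsSection`: the intertwining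
`g^{(m+1)} s_a = s_b g^{(m)}` is `s_b = (f_b/f_a) s_a`), i.e. the sheaf maps
`𝒪(L_m) →ˢ 𝒪(L_{m+1})` of Serre's exact sequences of a hyperplane section (FAC n° 81; GAGA n° 16
Lemme 8), acting on the Čech complexes of `HolomorphicLineBundleCechTwist` by `mulCochain`; they
are injective on cochains as soon as `s ∉ I(X)`-type density holds
(`cechSet_subset_closure_coord_ne_zero` feeds `mulCochain_injective`).

Everything is proved; the definitions are `twistBundle` and `homSectionOfIsSection`.

## References

* J.-P. Serre, *Géométrie algébrique et géométrie analytique*, Ann. Inst. Fourier 6 (1956), n° 16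
  Lemme 8. [SerreGAGA1956]
* U. Görtz, T. Wedhorn, *Algebraic Geometry I* (2020), (11.9), Prop. 11.21. [GortzWedhorn2020]
-/

noncomputable section

open scoped Manifold ContDiff Topology
open CategoryTheory AlgebraicGeometry TopologicalSpace Set
open Literature.AlgebraicGeometry.Motives
open Literature.AlgebraicGeometry.Motives.RatFn
open Literature.AlgebraicGeometry.Motives.AlgPoints
open Literature.NumberTheory.Transcendental
open Literature.Geometry.Kaehler

namespace Literature.AlgebraicGeometry.HodgeTheory

variable {X : SchemeOver ℂ} [IsIntegral X.left] {n : ℕ}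
  {E : Type*} [NormedAddCommGroup E] [NormedSpace ℂ E] [FiniteDimensional ℂ E]
  {M : Type*} [TopologicalSpace M] [ChartedSpace E M]
  {φ : M → ComplexPoints X} (hφ : IsAnalytification E X n φ) (H : CartierDivisor X.left)

/-! ### Multiples of a Cartier divisor: the cocycle is the power of the cocycle -/

omit [IsIntegral X.left] in
/-- Evaluation of a power of a regular function at a complex point of its open set. [folklore] -/
theorem evalOrZero_pow {U : X.left.Opens} (s : Γ(X.left, U)) {P : ComplexPoints X} (hP : P.pt ∈ U) (m : ℕ) :
    evalOrZero U (s ^ m) P = evalOrZero U s P ^ m := by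
  rw [evalOrZero_of_mem _ hP, evalOrZero_of_mem _ hP, ← evalRingHom_apply, ← evalRingHom_apply, map_pow]

omit [IsIntegral X.left] in
/-- The value of a regular function at a complex point depends only on its germ at the underlying
point (`eval` is the residue of the germ, pushed into `ℂ`). [folklore] -/
theorem eval_eq_of_germ_eq {U V : X.left.Opens} (P : ComplexPoints X) (hU : P.pt ∈ U) (hV : P.pt ∈ V)
    {f : Γ(X.left, U)} {g : Γ(X.left, V)}
    (h : X.left.presheaf.germ U P.pt hU f = X.left.presheaf.germ V P.pt hV g) :
    P.eval U hU f = P.eval V hV g := by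
  change P.resHom (X.left.evaluation U P.pt hU f) = P.resHom (X.left.evaluation V P.pt hV g)
  rw [← Scheme.germ_residue, ← Scheme.germ_residue, CommRingCat.comp_apply, CommRingCat.comp_apply, h]

/-- **The analytic cocycle of `𝒪_X(m • H)^an` is the `m`-th power of that of `𝒪_X(H)^an`** on the
trivialising sets: the germs of `f_b^m / f_a^m` and `(f_b / f_a)^m` agree in `𝒪_{X,x} ⊆ K(X)`
(`toFunctionField_germ_transFun`, injectivity of `𝒪_{X,x} → K(X)`), and evaluation at a complex
point is a ring homomorphism on germs. [cite: SerreGAGA1956, §3 n°9] [cite: GortzWedhorn2020, (11.9)] -/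
theorem cartierDivisorLineBundle_nsmul_coordChange (m : ℕ) (a b : H.ι) {x : M}
    (ha : (φ x).pt ∈ H.U a) (hb : (φ x).pt ∈ H.U b) :
    (cartierDivisorLineBundle hφ (m • H)).coordChange a b x =
      (cartierDivisorLineBundle hφ H).coordChange a b x ^ m := by
  set P := φ x
  have hP : P.pt ∈ H.U b ⊓ H.U a := ⟨hb, ha⟩
  -- the germs of `f_b^m/f_a^m` and `(f_b/f_a)^m` agree
  have hg : X.left.presheaf.germ (H.U b ⊓ H.U a) P.pt hP ((H.nsmul m).transFun b a) =
      X.left.presheaf.germ (H.U b ⊓ H.U a) P.pt hP (H.transFun b a ^ m) := by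
    apply toFunctionField_injective
    have h1 : toFunctionField P.pt (X.left.presheaf.germ (H.U b ⊓ H.U a) P.pt hP ((H.nsmul m).transFun b a)) =
        (H.nsmul m).f b / (H.nsmul m).f a := (H.nsmul m).toFunctionField_germ_transFun hP
    have h2 : toFunctionField P.pt (X.left.presheaf.germ (H.U b ⊓ H.U a) P.pt hP (H.transFun b a)) =
        H.f b / H.f a := H.toFunctionField_germ_transFun hP
    rw [map_pow, map_pow, h2, h1]
    exact (div_pow (H.f b) (H.f a) m).symm
  change evalOrZero ((H.nsmul m).U b ⊓ (H.nsmul m).U a) ((H.nsmul m).transFun b a) P =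
    evalOrZero (H.U b ⊓ H.U a) (H.transFun b a) P ^ m
  have e1 : evalOrZero ((H.nsmul m).U b ⊓ (H.nsmul m).U a) ((H.nsmul m).transFun b a) P =
      P.eval (H.U b ⊓ H.U a) hP ((H.nsmul m).transFun b a) := evalOrZero_of_mem _ hP
  rw [e1, evalOrZero_of_mem _ hP, eval_eq_of_germ_eq P hP hP hg, ← evalRingHom_apply,
    ← evalRingHom_apply, map_pow]

/-- The trivialising sets of `𝒪_X(m • H)^an` are those of `𝒪_X(H)^an` (definitional). [folklore] -/
theorem cartierDivisorLineBundle_nsmul_baseSet (m : ℕ) (a : H.ι) :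
    (cartierDivisorLineBundle hφ (m • H)).baseSet a = (cartierDivisorLineBundle hφ H).baseSet a :=
  rfl

/-! ### The tower `L_m = L ⊗ 𝒪_X(mH)^an` -/

/-- **`L_m = L ⊗ 𝒪_X(m • H)^an`**, the twists of a cocycle line bundle by the multiples of a Cartier
divisor, all on the trivialising cover `U_i ∩ φ⁻¹(U_a(ℂ))` (index `ι × H.ι`).
[cite: SerreGAGA1956, n°16 Lemme 8] -/
abbrev twistBundle {ι : Type*} (L : HolomorphicLineBundle ι E M) (m : ℕ) : HolomorphicLineBundle (ι × H.ι) E M :=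
  L.tensor (cartierDivisorLineBundle hφ (m • H))

/-- The trivialising sets of the tower do not depend on `m` (definitional). [folklore] -/
@[simp]
theorem twistBundle_baseSet {ι : Type*} (L : HolomorphicLineBundle ι E M) (m : ℕ) (p : ι × H.ι) :
    (twistBundle hφ H L m).baseSet p = L.baseSet p.1 ∩ φ ⁻¹' {P | P.pt ∈ H.U p.2} :=
  rfl

/-- The transition functions of the tower: `g_ij · (g^H_ab)^m`. [cite: SerreGAGA1956, §3 n°9] -/
theorem twistBundle_coordChange {ι : Type*} (L : HolomorphicLineBundle ι E M) (m : ℕ) (p q : ι × H.ι) {x : M}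
    (hp : (φ x).pt ∈ H.U p.2) (hq : (φ x).pt ∈ H.U q.2) :
    (twistBundle hφ H L m).coordChange p q x =
      L.coordChange p.1 q.1 x * (cartierDivisorLineBundle hφ H).coordChange p.2 q.2 x ^ m := by
  change L.coordChange p.1 q.1 x * (cartierDivisorLineBundle hφ (m • H)).coordChange p.2 q.2 x = _
  rw [cartierDivisorLineBundle_nsmul_coordChange hφ H m p.2 q.2 hp hq]

/-! ### Multiplication by an algebraic section of `𝒪_X(H)` -/

section HomSection

variable {ι : Type*} (L : HolomorphicLineBundle ι E M) {s : X.left.functionField} (hs : H.IsSection s)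

/-- **An algebraic section `s ∈ Γ(X, 𝒪_X(H))` as a section of `Hom(L_m, L_{m+1})`** for every `m`:
coordinates `s_a = (f_a s) ∘ φ` (`CartierDivisor.sectionCoord`), holomorphic on `φ⁻¹(U_a(ℂ))`, with
the intertwining `g_{L_{m+1}} s_a = s_b g_{L_m}` (`sectionCoord_eq_mul`: `s_b = g^H_ab s_a`). This is
the sheaf map "multiplication by `s`" `𝒪(L ⊗ 𝒪(mH)) → 𝒪(L ⊗ 𝒪((m+1)H))` of Serre's sequences.
[cite: SerreGAGA1956, n°16 Lemme 8 (proof)] -/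
def homSectionOfIsSection (m : ℕ) :
    HolomorphicLineBundle.HomSection (twistBundle hφ H L m) (twistBundle hφ H L (m + 1)) where
  coord p := H.sectionCoord φ hs p.2
  mdifferentiableOn_coord p := (mdifferentiableOn_sectionCoord hφ hs p.2).mono fun _ hx ↦ hx.1.2
  coordChange_mul_coord p q x hx := by
    have hp : (φ x).pt ∈ H.U p.2 := hx.1.1.2
    have hq : (φ x).pt ∈ H.U q.2 := hx.1.2.2
    rw [twistBundle_coordChange hφ H L (m + 1) p q hp hq, twistBundle_coordChange hφ H L m p q hp hq,
      sectionCoord_eq_mul hs hp hq, pow_succ]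
    change L.coordChange p.1 q.1 x * ((cartierDivisorLineBundle hφ H).coordChange p.2 q.2 x ^ m *
        (cartierDivisorLineBundle hφ H).coordChange p.2 q.2 x) * H.sectionCoord φ hs p.2 x =
      (cartierDivisorLineBundle hφ H).coordChange p.2 q.2 x * H.sectionCoord φ hs p.2 x *
        (L.coordChange p.1 q.1 x * (cartierDivisorLineBundle hφ H).coordChange p.2 q.2 x ^ m)
    ring

/-- The coordinates of `homSectionOfIsSection` (definitional). [folklore] -/
@[simp]
theorem homSectionOfIsSection_coord (m : ℕ) (p : ι × H.ι) :
    (homSectionOfIsSection hφ H L hs m).coord p = H.sectionCoord φ hs p.2 :=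
  rfl

/-- **Density input for injectivity**: if the non-vanishing locus of the coordinates of `s` is dense
(`s` vanishes identically on no component; Serre, GAGA Prop. 5 — on the analytification of an integral
`X` this is `BertiniPencilAnalytic.exists_transverse_flag`'s last clause), then every member `V_J` of
a framed cover of `L_m` lies in the closure of `{s_{frame J₀} ≠ 0}` — the hypothesis of
`FramedCover.mulCochain_injective`. [cite: SerreGAGA1956, n°7 Prop. 5] -/
theorem cechSet_subset_closure_coord_ne_zero {κ : Type*} {m : ℕ} (C : (twistBundle hφ H L m).FramedCover κ)
    (hdense : Dense {x : M | ∀ a : H.ι, (φ x).pt ∈ H.U a → H.sectionCoord φ hs a x ≠ 0})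
    {k : ℕ} (J : Fin (k + 1) → κ) :
    cechSet C.U J ⊆ closure {x | (homSectionOfIsSection hφ H L hs m).coord (C.frame (J 0)) x ≠ 0} := by
  intro x hx
  have hopen : IsOpen (cechSet C.U J) := isOpen_cechSet C.isOpen J
  have h1 : x ∈ closure (cechSet C.U J ∩ {x : M | ∀ a : H.ι, (φ x).pt ∈ H.U a → H.sectionCoord φ hs a x ≠ 0}) :=
    hopen.inter_closure ⟨hx, hdense.closure_eq.symm ▸ mem_univ x⟩
  refine closure_mono ?_ h1
  rintro y ⟨hyJ, hy⟩
  have hb : y ∈ (twistBundle hφ H L m).baseSet (C.frame (J 0)) := C.cechSet_subset_baseSet J 0 hyJ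
  exact hy (C.frame (J 0)).2 hb.2

end HomSection

end Literature.AlgebraicGeometry.HodgeTheory

end
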